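import Literature.MathematicalPhysics.QuantumLattice.GrassmannKernelsGenProd
import HarnessLib

/-!
# Kernels of presented Grassmann polynomials: antisymmetrisation and the `L¹–L^∞` norm

Topic `Literature/MathematicalPhysics/QuantumLattice`; continues `GrassmannKernelsGenProd.lean`.  A
homogeneous Grassmann polynomial PRESENTED by a coefficient function `φ`,
`Φ = Σ_{Y : Fin m → Γ} φ(Y) · ψ(Y_0)⋯ψ(Y_{m-1})` (the form in which the tree expansion produces the
effective potentials: `GrassmannKernelVertices.lean`), has as its `m`-point kernel the
ANTISYMMETRISATION of `φ`, `kernel Φ m X = (m!)⁻¹ Σ_σ sign σ · φ(X ∘ σ)` (Salmhofer 1999, (4.95); Berezin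
1966, Ch. I §3), and no kernel in the other degrees.  Since Salmhofer's `L¹–L^∞` norm (`kernelNorm`,
Salmhofer 1998, §4.1) is invariant under permutations of the arguments, the kernel norm of `Φ` is at most
that of its presentation: `‖kernel Φ m‖ ≤ ‖φ‖` — the step that converts positional (`L¹–L^∞`) estimates on
presentations into estimates on Salmhofer's kernels without any factorial loss.

* `presented R φ = Σ_Y φ(Y) • genProd R Y`;
* **`kernel_presented`** — `kernel (presented φ) m X = (m!)⁻¹ Σ_σ sign σ · φ(X ∘ σ)`; `kernel_presented_of_ne`;
* `pinnedSum_le_kernelNorm`, `kernelNorm_succ_le_of_forall` — the two directions of the `max sup` in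
  `kernelNorm`; `pinnedSum_comp_perm` — permutation invariance of the pinned sums;
* **`kernelNorm_kernel_presented_le`** — `kernelNorm ε m (kernel (presented φ) m) ≤ kernelNorm ε m φ`.

Everything is proved; no named fact.

## Sources

M. Salmhofer, *Renormalization* (1999), §4.3 (4.95) (`Salmhofer1999`); M. Salmhofer, Comm. Math. Phys.
194 (1998) 249–295, §3.2 (3.12), §4.1 (`Salmhofer1998`); F. A. Berezin, *The Method of Second
Quantization* (1966), Ch. I §3 (`Berezin1966`).
-/

noncomputable section

namespace Literature.MathematicalPhysics.QuantumLattice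

open GrassmannAlgebra Finset Matrix

section Presented

variable (R : Type*) [CommRing R] {Γ : Type*} [DecidableEq Γ] [Fintype Γ]

/-- The homogeneous polynomial **presented** by the coefficient function `φ`:
`Σ_{Y : Fin m → Γ} φ(Y) · ψ(Y_0)⋯ψ(Y_{m-1})`. [cite: Salmhofer1998, §3.2 (3.12)] -/
def presented {m : ℕ} (φ : (Fin m → Γ) → R) : GrassmannAlgebra R Γ := ∑ Y, φ Y • genProd R Y

variable [Algebra ℚ R]

omit [DecidableEq Γ] [Fintype Γ] in
/-- Kernels of finite sums. [folklore] -/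
theorem kernel_sum {α : Type*} (s : Finset α) (F : α → GrassmannAlgebra R Γ) (m : ℕ) (X : Fin m → Γ) :
    kernel R (∑ a ∈ s, F a) m X = ∑ a ∈ s, kernel R (F a) m X := by
  classical
  induction s using Finset.induction_on with
  | empty => simp
  | insert a s ha ih => rw [sum_insert ha, sum_insert ha, kernel_add, ih]

omit [Algebra ℚ R] in
/-- The delta determinant against `φ` picks out the antisymmetrisation:
`Σ_Y φ(Y) det [δ_{X_i, Y_j}] = Σ_σ sign σ · φ(X ∘ σ)`. [folklore] -/
theorem sum_mul_det_deltaMatrix {m : ℕ} (φ : (Fin m → Γ) → R) (X : Fin m → Γ) :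
    ∑ Y, φ Y * (deltaMatrix R X Y).det = ∑ σ : Equiv.Perm (Fin m), Equiv.Perm.sign σ • φ (X ∘ σ) := by
  classical
  simp_rw [Matrix.det_apply, mul_sum]
  rw [sum_comm]
  refine sum_congr rfl fun σ _ => ?_
  -- only `Y = X ∘ σ` survives the product of deltas
  have hprod : ∀ Y : Fin m → Γ, (∏ i, deltaMatrix R X Y (σ i) i) = if Y = X ∘ σ then 1 else 0 := by
    intro Y
    by_cases hY : Y = X ∘ σ
    · rw [if_pos hY]
      exact prod_eq_one fun i _ => by rw [deltaMatrix_apply, if_pos (by rw [hY]; rfl)]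
    · rw [if_neg hY]
      obtain ⟨i, hi⟩ : ∃ i, X (σ i) ≠ Y i := by
        by_contra h
        push Not at h
        exact hY (funext fun i => (h i).symm)
      exact prod_eq_zero (mem_univ i) (by rw [deltaMatrix_apply, if_neg hi])
  simp_rw [hprod, smul_ite, smul_zero, mul_ite, mul_zero]
  rw [sum_ite_eq' univ (X ∘ σ), if_pos (mem_univ _), Units.smul_def, Units.smul_def, zsmul_eq_mul,
    zsmul_eq_mul, mul_one, mul_comm]

/-- **The kernel of a presented polynomial is the antisymmetrisation of its presentation**:
`kernel (Σ_Y φ(Y) ψ(Y)) m X = (m!)⁻¹ Σ_σ sign σ · φ(X ∘ σ)`. [cite: Salmhofer1999, §4.3 (4.95)] -/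
theorem kernel_presented {m : ℕ} (φ : (Fin m → Γ) → R) (X : Fin m → Γ) :
    kernel R (presented R φ) m X =
      ((m.factorial : ℚ)⁻¹ • (1 : R)) * ∑ σ : Equiv.Perm (Fin m), Equiv.Perm.sign σ • φ (X ∘ σ) := by
  rw [presented, kernel_sum, ← sum_mul_det_deltaMatrix, mul_sum]
  refine sum_congr rfl fun Y _ => ?_
  rw [kernel_smul, kernel_genProd]
  ring

/-- A presented polynomial of degree `m` has no kernels in the other degrees. [folklore] -/
theorem kernel_presented_of_ne {m' m : ℕ} (φ : (Fin m → Γ) → R) (X : Fin m' → Γ) (h : m' ≠ m) :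
    kernel R (presented R φ) m' X = 0 := by
  rw [presented, kernel_sum]
  exact sum_eq_zero fun Y _ => by rw [kernel_smul, kernel_genProd_of_ne R X Y h, mul_zero]

end Presented

/-! ### The `L¹–L^∞` norm of the kernels of a presented polynomial -/

section Norms

variable {𝕜 : Type*} [RCLike 𝕜] {Γ : Type*} [Fintype Γ] [DecidableEq Γ]

/-- Each pinned sum is at most the kernel norm. [folklore] -/
theorem pinnedSum_le_kernelNorm (ε : ℝ) (m : ℕ) (K : (Fin (m + 1) → Γ) → 𝕜) (p : Fin (m + 1)) (x : Γ) :
    ε ^ m * ∑ X ∈ univ.filter (fun X : Fin (m + 1) → Γ => X p = x), ‖K X‖ ≤ kernelNorm ε (m + 1) K := by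
  rw [kernelNorm_succ]
  exact le_ciSup_of_le (Finite.bddAbove_range _) p
    (le_ciSup_of_le (Finite.bddAbove_range _) x le_rfl)

/-- The kernel norm is at most `B` when every pinned sum is. [folklore] -/
theorem kernelNorm_succ_le_of_forall (ε : ℝ) (m : ℕ) (K : (Fin (m + 1) → Γ) → 𝕜) {B : ℝ} (hB : 0 ≤ B)
    (h : ∀ (p : Fin (m + 1)) (x : Γ), ε ^ m * ∑ X ∈ univ.filter (fun X : Fin (m + 1) → Γ => X p = x), ‖K X‖ ≤ B) :
    kernelNorm ε (m + 1) K ≤ B := by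
  rw [kernelNorm_succ]
  rcases isEmpty_or_nonempty Γ with hΓ | hΓ
  · simp [hB]
  · exact ciSup_le fun p => ciSup_le fun x => h p x

/-- **Permutation invariance of the pinned sums**: summing `‖φ(X ∘ σ)‖` over `X` with `X p` pinned is
summing `‖φ(Z)‖` over `Z` with `Z (σ⁻¹ p)` pinned. [folklore] -/
theorem pinnedSum_comp_perm {m : ℕ} (φ : (Fin (m + 1) → Γ) → 𝕜) (σ : Equiv.Perm (Fin (m + 1)))
    (p : Fin (m + 1)) (x : Γ) :
    ∑ X ∈ univ.filter (fun X : Fin (m + 1) → Γ => X p = x), ‖φ (X ∘ σ)‖ =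
      ∑ Z ∈ univ.filter (fun Z : Fin (m + 1) → Γ => Z (σ.symm p) = x), ‖φ Z‖ := by
  refine sum_nbij' (fun X => X ∘ σ) (fun Z => Z ∘ σ.symm) ?_ ?_ ?_ ?_ ?_
  · intro X hX
    refine mem_filter.2 ⟨mem_univ _, ?_⟩
    simpa using (mem_filter.1 hX).2
  · intro Z hZ
    refine mem_filter.2 ⟨mem_univ _, ?_⟩
    simpa using (mem_filter.1 hZ).2
  · intro X _; funext i; simp
  · intro Z _; funext i; simp
  · intro X _; rfl

/-- **The kernel norm of a presented polynomial is at most that of its presentation** (no factorial loss: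
the `(m!)⁻¹` of the antisymmetrisation compensates the `m!` permutations, each of which has the same
`L¹–L^∞` norm). [cite: Salmhofer1998, §4.1] -/
theorem kernelNorm_kernel_presented_le {ε : ℝ} (hε : 0 ≤ ε) : ∀ (m : ℕ) (φ : (Fin m → Γ) → 𝕜),
    kernelNorm ε m (kernel 𝕜 (presented 𝕜 φ) m) ≤ kernelNorm ε m φ
  | 0, φ => by
    rw [kernelNorm_zero_left, kernelNorm_zero_left, kernel_presented]
    have h1 : (univ : Finset (Equiv.Perm (Fin 0))) = {1} := by
      ext σ; simp [Subsingleton.elim σ 1]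
    rw [h1, sum_singleton, Equiv.Perm.sign_one, one_smul, Nat.factorial_zero, Nat.cast_one, inv_one, one_smul,
      one_mul]
    exact le_of_eq (congrArg _ (congrArg _ (funext fun i => i.elim0)))
  | m + 1, φ => by
    refine kernelNorm_succ_le_of_forall ε m _ (kernelNorm_nonneg hε _ _) fun p x => ?_
    -- `‖kernel‖ ≤ (m+1)!⁻¹ Σ_σ ‖φ(X ∘ σ)‖`
    have hpt : ∀ X : Fin (m + 1) → Γ, ‖kernel 𝕜 (presented 𝕜 φ) (m + 1) X‖ ≤
        ((m + 1).factorial : ℝ)⁻¹ * ∑ σ : Equiv.Perm (Fin (m + 1)), ‖φ (X ∘ σ)‖ := by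
      intro X
      rw [kernel_presented, norm_mul]
      have hfac : ‖(((m + 1).factorial : ℚ)⁻¹ • (1 : 𝕜))‖ = ((m + 1).factorial : ℝ)⁻¹ := by
        rw [Rat.smul_one_eq_cast, Rat.cast_inv, Rat.cast_natCast, norm_inv, RCLike.norm_natCast]
      rw [hfac]
      refine mul_le_mul_of_nonneg_left ((norm_sum_le _ _).trans (sum_le_sum fun σ _ => le_of_eq ?_))
        (by positivity)
      rw [Units.smul_def, norm_smul]
      rcases Int.units_eq_one_or (Equiv.Perm.sign σ) with h | h <;> simp [h]
    calc ε ^ m * ∑ X ∈ univ.filter (fun X : Fin (m + 1) → Γ => X p = x), ‖kernel 𝕜 (presented 𝕜 φ) (m + 1) X‖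
        ≤ ε ^ m * ∑ X ∈ univ.filter (fun X : Fin (m + 1) → Γ => X p = x),
            (((m + 1).factorial : ℝ)⁻¹ * ∑ σ : Equiv.Perm (Fin (m + 1)), ‖φ (X ∘ σ)‖) :=
          mul_le_mul_of_nonneg_left (sum_le_sum fun X _ => hpt X) (pow_nonneg hε m)
      _ = ((m + 1).factorial : ℝ)⁻¹ * ∑ σ : Equiv.Perm (Fin (m + 1)),
            (ε ^ m * ∑ Z ∈ univ.filter (fun Z : Fin (m + 1) → Γ => Z (σ.symm p) = x), ‖φ Z‖) := by
          rw [← mul_sum, sum_comm, mul_left_comm, mul_sum]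
          refine congrArg _ (sum_congr rfl fun σ _ => ?_)
          rw [pinnedSum_comp_perm]
      _ ≤ ((m + 1).factorial : ℝ)⁻¹ * ∑ _σ : Equiv.Perm (Fin (m + 1)), kernelNorm ε (m + 1) φ :=
          mul_le_mul_of_nonneg_left (sum_le_sum fun σ _ => pinnedSum_le_kernelNorm ε m φ _ x) (by positivity)
      _ = kernelNorm ε (m + 1) φ := by
          rw [sum_const, card_univ, Fintype.card_perm, Fintype.card_fin, nsmul_eq_mul, ← mul_assoc,
            inv_mul_cancel₀ (by positivity), one_mul]

end Norms

end Literature.MathematicalPhysics.QuantumLattice
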